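import Literature.Claims.NS.ClayVariants
import Literature.Analysis.FluidPDE.TaoLocalisation
import HarnessLib

/-!
# Claim skeleton (D-0090 NS-CLAIMS, C111): M. Al-Zawahreh, «Global Regularity for the 3D Navier-Stokes
# Equations: Spectral-Geometric Proof & Lean 4 Formal Verification», Zenodo 18974531 (2026) — Lean-artefact
# QUICK row

Cell `ns-claims`, row C111 (T2-low QUICK, «C81 treatment»; lead ruling 2026-08-26T20:50:52Z (2): «transcribe
the top statement + the defs it unfolds to over OUR vocabulary, axioms as hypotheses; never import their
repo»), typist `ns-claims-typist-12` (lanes: refuter-8, ref-4, salvage-p4 nominal, writer-2). Deposit of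
record (PINNED by ns-claims-lit-1 g3, `pub/ns-claims/sources/AlZawahreh2026/LOCATORS.md` §0): Zenodo record
18974531 (DOI 10.5281/zenodo.18974531, concept 18974530, only version, 2026-03-12) = ONE PDF (8 pp., «March
2026 — Revision 2»; locators «p.N», text layer `sources/AlZawahreh2026/text/`), bib `AlZawahreh2026NSLean`.
The deposit holds NO Lean sources; the paper §6.4 p.5 names «Repository: github.com/merchantmoh-debug/
Navier-Stokes-» (truncated in print) and lit-1 matched the public repository `merchantmoh-debug/
Navier-Stokes-Lean-4-Solution` (branch main, README citing this DOI; snapshot `ns-lean4-solution-main.zip`,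
2026-08-26; `lean-toolchain` v4.29.0-rc6, Mathlib rev 77a266ed3884; `src/NS_Core/*.lean` = the paper's «7
source files», 460 lines; locators «File.lean:N»). Not built here and NOT imported: the artefact's
definitions are TRANSCRIBED below and its one consumed axiom becomes a HYPOTHESIS. UNREFEREED CLAIM under
adjudication — NOTHING in this file asserts a statement of the paper about Navier–Stokes: the paper's
sentence and the artefact's axiom/capstone are `def … : Prop`; the `theorem`s are kernel facts about them
and the Clay link. Card `pub/ns-claims/claims/AlZawahreh2026/CARD.md` (PREDICTION §4 frozen 21:52:40Z, sha16
46a34c8684a7150f).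

## The claimed statement (paper, as printed)

Abstract p.1: «We prove global regularity for the 3D incompressible Navier-Stokes equations for
divergence-free initial data u₀ ∈ H¹(R³). … The proof is analytically self-contained. Multi-layer
computational validation and Lean 4 formal verification (2544 compilation jobs, zero errors) provide
independent confirmation.» §1.1 p.1: «given smooth, divergence-free initial data u₀ ∈ H¹(R³), does the
system ∂_t u + (u·∇)u = −∇p + νΔu, ∇·u = 0 (1) admit a unique smooth solution for all t > 0?» — `ClaimedTheorem`:
the (A)-type sentence typed in the tree's Clay schema (`ClayVariants.ClaySpec`) with the data slot «u₀ ∈ H¹»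
on top of smooth and divergence-free (`claySpecH1`); Clay-sense solution = smooth `(u, p)` on `ℝ³ × [0,∞)`
solving (1)–(3) with bounded energy. Uniqueness («unique smooth solution») is not typed (TODO(general form)).
§6.4 p.5 «Layer 4: Lean 4 Formal Verification»: «Full formalization in Lean 4 with Mathlib, compiled
successfully: • 7 source files, 2544 compilation jobs • Main theorem: global_regularity_ns • Zero compilation
errors». The paper's analytic skeleton (pp.2–4: Lamb-vector identity / Beltrami alignment Prop. 2.5,
Cheeger / Witten-Laplacian spectral gap, helicity dissipation, BKM / Ladyzhenskaya–Prodi–Serrin chain) is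
NOT typed in this QUICK row (lead: the artefact's top statement and what it unfolds to); a print-side typing
would be a separate T2 skeleton.

## The artefact (transcribed; `src/NS_Core/`)

* Carrier (NavierStokes.lean:21–26): `variable {E : Type*} [NormedAddCommGroup E] [InnerProductSpace ℝ E]
  [FiniteDimensional ℝ E]` — «E represents ℝ^(3N) where N is the number of Fourier modes» (a comment; no
  Fourier object occurs). `def viscosity : ℝ := 0.01` (l.28–29). `structure VelocityField (E) where val : E`
  (l.40–42). `def kineticEnergy (u) : ℝ := (1/2) * ‖u.val‖^2` (l.44–46). **`structure NSEvolution (E) where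
  u : ℝ → VelocityField E; u₀ : VelocityField E; initial : u 0 = u₀`** (l.52–56) — NO equation: every
  time-indexed family with the right value at `t = 0` is an «NS evolution». **`axiom energy_dissipation :
  ∀ (sol : NSEvolution E) (t : ℝ), t > 0 → kineticEnergy (sol.u t) ≤ kineticEnergy sol.u₀`** (l.58–62) —
  transcribed as the HYPOTHESIS `Axiom_energyDissipation E`.
* BeltramiAlignment.lean:39–43: `theorem tao_barrier_satisfied : True := by trivial`; `theorem euler_failure :
  viscosity > 0 := by unfold viscosity; norm_num` (re-proved here).
* **Top theorem** (GlobalRegularity.lean:53–70, docstring l.37–52 «Main Theorem (Global Regularity for 3D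
  Navier-Stokes) Let u₀ ∈ H¹(ℝ³) be divergence-free. Then there exists a unique global smooth solution
  u ∈ C∞(ℝ³ × (0,∞)) to the incompressible Navier-Stokes equations with ν > 0. Proof Architecture: 1. …
  7. BKM regularity (bkm_regularity): no blow-up»): `theorem global_regularity_ns : viscosity > 0 ∧ True ∧
  (∀ (sol : NSEvolution E) (t : ℝ), t > 0 → kineticEnergy (sol.u t) ≤ kineticEnergy sol.u₀) := by
  constructor · exact euler_failure; constructor · exact tao_barrier_satisfied · intro sol t ht; exact
  energy_dissipation sol t ht` — transcribed as `Capstone E` (verbatim type) with the artefact's proof re-run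
  from the hypothesis (`capstone_of_axiom`). Kernel fact `capstone_iff_axiom`: the capstone IS its axiom
  (conjuncts (i) `0.01 > 0` and (ii) `True` carry nothing) — hypothesis = conclusion.
* Census (lit-1, lake-free, `src/`): `sorry` 0 · `opaque` 0 · `native_decide` 0 · `axiom` 11 —
  NavierStokes.lean:60 `energy_dissipation` (the ONLY one the top theorem consumes); SpectralGap.lean:27
  `stokes_spectral_gap_positive`, :32 `cheeger_inequality`; Helicity.lean:22 `helicity_dissipation`, :28
  `δ_min_pos`; BeltramiAlignment.lean:21 `lamb_vector_identity : ∀ u, True`, :26 `beltrami_kills_stretching :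
  ∀ u, beltrami_departure u = 0 → enstrophy u ≤ enstrophy u`, :32 `stretching_proportional_to_departure`;
  Enstrophy.lean:19 `stretching_bound`, :28 `bkm_regularity : … → ‖(sol.u t).val‖ ≥ 0`, :34
  `poincare_enstrophy`; GlobalRegularity.lean:111–119 lists them as «Physical axioms (justified by literature
  + computational stack)» (not as hypotheses of a conditional claim). No declaration in `src/` mentions
  smoothness, existence of a solution, `ℝ³`, divergence, pressure or a differential equation.

## Steps — ORDERED INDEX (TYPING-HYGIENE 11; dependency order of the artefact's top theorem)

Step 1 = `Axiom_energyDissipation` (NavierStokes.lean:58–62; consumed at GlobalRegularity.lean:69–70) — the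
load-bearing item; typist's private flag: suspicious as an axiom over THESE definitions (an `NSEvolution`
obeys no dynamics, so energy non-increase is a statement about every time-indexed family in every
finite-dimensional inner-product space). Step 2 = `Capstone` (GlobalRegularity.lean:53–70) = Step 1 ∧
`0.01 > 0` ∧ `True` (`capstone_iff_axiom`). Step 3 = `Step_bridge` (§6.4 p.5 «Main theorem:
global_regularity_ns» + docstring l.37–42): «the artefact's theorem, for every carrier, IS the paper's
sentence» — no Navier–Stokes object has a typed counterpart in the artefact (typist's flag: wrong problem on
every Δ-axis; and, if Step 1 fails over some carrier, vacuously true). COMPOSITION: `claim_of_steps :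
AxiomAll → Step_bridge → ClaimedTheorem` (modus ponens through `capstoneAll_of_axiomAll`) — PROVED; and
`clay_of_claimed : ClaimedTheorem → ClayVariants.clayR3.Regularity` — PROVED (Schwartz data are `H¹`), so no
wrong-problem axis separates the PAPER's sentence from Clay (A) (it is (A)-STRONGER on Δ4); the wrong-problem
axes all sit between the ARTEFACT and the paper (Step 3).

## Clay delta (reference `Literature.Claims.NS.ClayVariants`, axes Δ1–Δ8)

Paper's sentence: nearest (A); Δ1 `ℝ³` = · Δ2 (1)–(3) = · Δ3 `f ≡ 0` = · Δ4 data smooth, divergence-free,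
`u₀ ∈ H¹(ℝ³)` ⊋ (4): STRONGER · Δ5/Δ6 smooth solution for all `t > 0`, energy bounded (= (6), (7)) · Δ7
every `ν > 0` (the artefact fixes `ν = 0.01`). Artefact's theorem: no axis of the schema present (Δ1 abstract
finite-dimensional `E`; Δ2 no equation; Δ4 none; Δ5 `NSEvolution = {u, u₀, u 0 = u₀}`; Δ6 `(0.01 > 0) ∧ True
∧ energy non-increase`; Δ7 `ν = 0.01`).

Design notes. The artefact's namespaces (`ARK.NS`, `ARK.Main`, …) are not reproduced; names are kept
(`viscosity`, `VelocityField`, `kineticEnergy`, `NSEvolution`, `euler_failure`, `tao_barrier_satisfied`)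
inside this file's namespace. The relations `>`/`≥` are kept as the artefact prints them. The universally
quantified forms `AxiomAll` / `CapstoneAll` range over carriers in `Type` (the artefact's section variable is
universe-polymorphic; nothing here depends on the universe). No notation, no instance.

WHAT THIS IS NOT: not a claim about NS regularity or blow-up; not a claim about any author beyond the
typed locator.
-/

noncomputable section

open MeasureTheory Literature.Analysis.FluidPDE
open scoped ENNReal ContDiff

namespace Literature.Claims.NS.AlZawahreh2026

/-! ### The paper's sentence in the Clay schema -/

/-- The data slot «u₀ ∈ H¹(ℝ³)» (abstract p.1, §1.1 p.1), ON TOP of smooth and divergence-free (which the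
schema `ClaySpec.RegularityAt` already imposes): `u₀` and its first derivative are square-integrable.
[cite: AlZawahreh2026NSLean, abstract p.1; §1.1 p.1] -/
def IsH1Datum (u₀ : EuclideanSpace ℝ (Fin 3) → EuclideanSpace ℝ (Fin 3)) : Prop :=
  ∀ n : ℕ, n ≤ 1 → ∫⁻ x, ‖iteratedFDeriv ℝ n u₀ x‖ₑ ^ 2 < ⊤

/-- The paper's problem as a Clay-type spec: data (4) replaced by «H¹», forces as in (5) (unused: `f ≡ 0`),
admissibility (7) bounded energy. [cite: AlZawahreh2026NSLean, abstract p.1; §1.1 p.1] -/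
def claySpecH1 : ClayVariants.ClaySpec where
  data := IsH1Datum
  force := HasRapidSpaceTimeDecay
  admissible := fun u _ => HasBoundedEnergy u

/-- **The claimed statement** (abstract p.1 «We prove global regularity for the 3D incompressible
Navier-Stokes equations for divergence-free initial data u₀ ∈ H¹(R³)»; §1.1 (1); docstring of
`global_regularity_ns`, GlobalRegularity.lean:37–42): for every `ν > 0` and every smooth divergence-free
`u₀ ∈ H¹(ℝ³)` there are smooth `u, p` on `ℝ³ × [0,∞)` solving (1)–(3) from `u₀` with bounded energy.
RENDERING: the schema's Clay-sense solution (smooth on the closed half-space, energy bounded) for the print's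
«unique smooth solution for all t > 0»; uniqueness not typed. TODO(general form): uniqueness clause.
[cite: AlZawahreh2026NSLean, abstract p.1; §1.1 p.1; GlobalRegularity.lean:37–42] -/
def ClaimedTheorem : Prop :=
  claySpecH1.Regularity

/-- **Clay link (TYPING-HYGIENE 10(a))**: the claimed statement implies Clay (A) — a Schwartz-class datum (4)
is an `H¹` datum (`HasRapidSpatialDecay.lintegral_enorm_iteratedFDeriv_sq_lt_top`), and the solution notion
is the schema's. PROVED; the paper's sentence is (A)-STRONGER on Δ4 and carries no wrong-problem axis.
[cite: AlZawahreh2026NSLean, abstract p.1] -/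
theorem clay_of_claimed (h : ClaimedTheorem) : ClayVariants.clayR3.Regularity := by
  intro ν hν u₀ hsmooth hdiv hdecay
  have hH1 : IsH1Datum u₀ := fun n _ =>
    HasRapidSpatialDecay.lintegral_enorm_iteratedFDeriv_sq_lt_top (μ := volume) hdecay n
  obtain ⟨u, p, hu, hp, hns, hE⟩ := h ν hν u₀ hsmooth hdiv hH1
  exact ⟨u, p, hu, hp, hns, hE⟩

/-! ### The artefact, transcribed (NavierStokes.lean, BeltramiAlignment.lean, GlobalRegularity.lean) -/

/-- `def viscosity : ℝ := 0.01` — «Kinematic viscosity ν > 0» (NavierStokes.lean:28–29).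
[cite: AlZawahreh2026NSLean, NavierStokes.lean:28–29] -/
def viscosity : ℝ := 0.01

/-- `structure VelocityField (E) where val : E` — «A velocity field in the Galerkin-truncated space»
(NavierStokes.lean:40–42). [cite: AlZawahreh2026NSLean, NavierStokes.lean:40–42] -/
structure VelocityField (E : Type*) [NormedAddCommGroup E] [InnerProductSpace ℝ E] where
  /-- the vector -/
  val : E

/-- `def kineticEnergy (u : VelocityField E) : ℝ := (1/2) * ‖u.val‖^2` (NavierStokes.lean:44–46).
[cite: AlZawahreh2026NSLean, NavierStokes.lean:44–46] -/
def kineticEnergy {E : Type*} [NormedAddCommGroup E] [InnerProductSpace ℝ E] (u : VelocityField E) : ℝ :=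
  (1 / 2) * ‖u.val‖ ^ 2

/-- `structure NSEvolution (E) where u : ℝ → VelocityField E; u₀ : VelocityField E; initial : u 0 = u₀` —
«The NS evolution as a time-parameterized family of velocity fields» (NavierStokes.lean:52–56). NO equation
is imposed. [cite: AlZawahreh2026NSLean, NavierStokes.lean:52–56] -/
structure NSEvolution (E : Type*) [NormedAddCommGroup E] [InnerProductSpace ℝ E] where
  /-- the time-indexed family -/
  u : ℝ → VelocityField E
  /-- the initial field -/
  u₀ : VelocityField E
  /-- `u 0 = u₀` -/
  initial : u 0 = u₀

/-- **Step 1 — the artefact's AXIOM `energy_dissipation`, as a hypothesis** (NavierStokes.lean:58–62, over the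
section carrier `[FiniteDimensional ℝ E]`): «The energy dissipation inequality: dE/dt ≤ −ν‖∇u‖² …» rendered by
the artefact as `∀ (sol : NSEvolution E) (t : ℝ), t > 0 → kineticEnergy (sol.u t) ≤ kineticEnergy sol.u₀`.
The ONLY axiom the top theorem consumes (GlobalRegularity.lean:69–70). Typist's flag: suspicious over these
definitions (`NSEvolution` carries no dynamics). [cite: AlZawahreh2026NSLean, NavierStokes.lean:58–62] -/
def Axiom_energyDissipation (E : Type*) [NormedAddCommGroup E] [InnerProductSpace ℝ E]
    [FiniteDimensional ℝ E] : Prop :=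
  ∀ (sol : NSEvolution E) (t : ℝ), t > 0 → kineticEnergy (sol.u t) ≤ kineticEnergy sol.u₀

/-- `theorem euler_failure : viscosity > 0` (BeltramiAlignment.lean:41–43; «Euler failure: proof requires
ν > 0»), re-proved: `0.01 > 0`. [cite: AlZawahreh2026NSLean, BeltramiAlignment.lean:41–43] -/
theorem euler_failure : viscosity > 0 := by
  unfold viscosity; norm_num

/-- `theorem tao_barrier_satisfied : True` (BeltramiAlignment.lean:39–40; «Tao barrier satisfied: proof is
NS-specific by construction»). [cite: AlZawahreh2026NSLean, BeltramiAlignment.lean:39–40] -/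
theorem tao_barrier_satisfied : True := trivial

/-- **Step 2 — the TYPE of the top theorem `global_regularity_ns`, verbatim** (GlobalRegularity.lean:53–60;
§6.4 p.5 «Main theorem: global_regularity_ns»): `viscosity > 0 ∧ True ∧ (∀ (sol : NSEvolution E) (t : ℝ),
t > 0 → kineticEnergy (sol.u t) ≤ kineticEnergy sol.u₀)`.
[cite: AlZawahreh2026NSLean, GlobalRegularity.lean:53–60] -/
def Capstone (E : Type*) [NormedAddCommGroup E] [InnerProductSpace ℝ E] [FiniteDimensional ℝ E] : Prop :=
  viscosity > 0 ∧ True ∧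
    (∀ (sol : NSEvolution E) (t : ℝ), t > 0 → kineticEnergy (sol.u t) ≤ kineticEnergy sol.u₀)

/-- The artefact's proof of `global_regularity_ns` (GlobalRegularity.lean:61–70), re-run with the axiom as a
hypothesis. [cite: AlZawahreh2026NSLean, GlobalRegularity.lean:61–70] -/
theorem capstone_of_axiom {E : Type*} [NormedAddCommGroup E] [InnerProductSpace ℝ E]
    [FiniteDimensional ℝ E] (h : Axiom_energyDissipation E) : Capstone E :=
  ⟨euler_failure, tao_barrier_satisfied, fun sol t ht => h sol t ht⟩

/-- **Kernel fact: the «main theorem» IS its axiom** — `Capstone E ↔ Axiom_energyDissipation E` (conjuncts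
`0.01 > 0` and `True` carry nothing): hypothesis = conclusion.
[cite: AlZawahreh2026NSLean, GlobalRegularity.lean:53–70; NavierStokes.lean:58–62] -/
theorem capstone_iff_axiom {E : Type*} [NormedAddCommGroup E] [InnerProductSpace ℝ E]
    [FiniteDimensional ℝ E] : Capstone E ↔ Axiom_energyDissipation E :=
  ⟨fun h => h.2.2, capstone_of_axiom⟩

/-- The axiom as the artefact states it — for EVERY finite-dimensional real inner-product carrier (the
section variable `{E : Type*} …` of NavierStokes.lean:26). [cite: AlZawahreh2026NSLean, NavierStokes.lean:26, 58–62] -/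
def AxiomAll : Prop :=
  ∀ (E : Type) [NormedAddCommGroup E] [InnerProductSpace ℝ E] [FiniteDimensional ℝ E],
    Axiom_energyDissipation E

/-- The top theorem as the artefact states it — for every carrier (GlobalRegularity.lean:31, 53–60).
[cite: AlZawahreh2026NSLean, GlobalRegularity.lean:31, 53–60] -/
def CapstoneAll : Prop :=
  ∀ (E : Type) [NormedAddCommGroup E] [InnerProductSpace ℝ E] [FiniteDimensional ℝ E], Capstone E

/-- `CapstoneAll ↔ AxiomAll` (pointwise `capstone_iff_axiom`).
[cite: AlZawahreh2026NSLean, GlobalRegularity.lean:53–70] -/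
theorem capstoneAll_iff_axiomAll : CapstoneAll ↔ AxiomAll :=
  ⟨fun h E _ _ _ => (h E).2.2, fun h E _ _ _ => capstone_of_axiom (h E)⟩

/-! ### The bridge (§6.4 p.5: the Lean theorem presented as the paper's Main Theorem) -/

/-- **Step 3 — the bridge «`global_regularity_ns` (for every carrier) IS the Main Theorem»** (§6.4 p.5
«Full formalization in Lean 4 with Mathlib … Main theorem: global_regularity_ns»; §7 p.7; docstring
GlobalRegularity.lean:37–42 placing the H¹(ℝ³) sentence over the theorem). No domain, equation, datum class,
solution notion, smoothness or existence statement occurs in `CapstoneAll`; typist's flag: wrong problem on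
every Δ-axis (and vacuously true whenever `CapstoneAll` fails). [cite: AlZawahreh2026NSLean, §6.4 p.5; GlobalRegularity.lean:37–52] -/
def Step_bridge : Prop :=
  CapstoneAll → ClaimedTheorem

/-- If the artefact's universally stated capstone fails over some carrier, the bridge holds vacuously — the
kernel shape of «the verified theorem cannot carry the paper's sentence». PROVED (logic).
[cite: AlZawahreh2026NSLean, §6.4 p.5] -/
theorem step_bridge_of_not_capstoneAll (h : ¬ CapstoneAll) : Step_bridge :=
  fun hc => absurd hc h

/-- **COMPOSITION** (the deposit's chain: axioms ⇒ `global_regularity_ns` ⇒ «Main Theorem»): the axiom for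
every carrier and the bridge give the paper's sentence — modus ponens. PROVED.
[cite: AlZawahreh2026NSLean, §6.4 p.5; GlobalRegularity.lean:53–70] -/
theorem claim_of_steps (hax : AxiomAll) (hbr : Step_bridge) : ClaimedTheorem :=
  hbr (capstoneAll_iff_axiomAll.mpr hax)

end Literature.Claims.NS.AlZawahreh2026

end
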